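import Literature.IUT.HodgeTheaters.GenuineFKitMergeInputsThetaSide
import Literature.IUT.HodgeTheaters.GenuineFKitMergeInputsLiftsAll
import Literature.IUT.HodgeTheaters.Cor53iiiAtBadPlace
import HarnessLib

/-!
# [IUTchI] Cor 5.3 (ii) bad slot at OUR stand-in (A) — the SURJECTIVITY half `hlift@hull` = `LiftsAll` IS A THEOREM: every Π_{C_F}-transporter of
# the kit's `Π_v̲` DESCENDS along the genuine augmentation `Π_v̲ ↠ G_v̲` and LIFTS to the hull `𝒞_v̲ = 𝒞⊢_v̲` (proof-only)

S. Mochizuki, *Inter-universal Teichmüller theory I*, kurims manuscript (May 2020), §5 Cor. 5.3 (ii) p. 144 l. 12–15 («the natural map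
`Isom(¹𝔉, ²𝔉) → Isom(¹𝔇, ²𝔇)` is bijective») and the argument printed for (iv), p. 144 l. 37–40 («since automorphisms of `𝒟_v = ℬ^temp(X̲̲_v)⁰`
necessarily arise from automorphisms of the scheme `X̲̲_v` [cf. [AbsTopIII], Theorem 1.9; [AbsTopIII], Remark 1.9.1], surjectivity follows immediately from
the construction of `ℱ̲_v`»); Cor. 5.3 (iii) p. 144 l. 16–19 («`Isom(¹𝔉⊢, ²𝔉⊢) → Isom(¹𝔇⊢, ²𝔇⊢)` is surjective»); Def. 3.1 (e) p. 62 (the natural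
outer surjections `Π_v̲ ↠ G_v̲` onto the decomposition groups); Ex. 3.2 (iv) p. 71 (`𝒞⊢_v` over `𝒟⊢_v`); Def. 6.1 (v) p. 158 (`Aut` of an embedded
connected object = normaliser quotient) ([IUTchI] Cor 5.3 (ii) p.144) [claim: Mochizuki2012, status: disputed] (D-0012 claim key; nothing of the
series is asserted; no side is taken on [IUTchIII] Cor. 3.12).  [cite: MochizukiFrdII2008, Ex 1.3 (ii) p.11] (pull-back functors).

PROOF-ONLY (cell abc-iut, seat abc-iut-L5-t4 gen 8, KEY R72 «COR53II-BAD-SLOT-LAWS@STAND-IN» part (3) — trigger: abc-iut-L5-t5 g8's sizing «the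
(m1) hull does not expose a TM-pair ⇒ INPUT-SHAPE»; abc-iut-L5-lead RULINGS #163).  THE LAW.  In the transporter form of abc-iut-L5-t16's read-out
(★ `InitialThetaData.badLiftsAllAt_iff`), `hlift@hull` at the `ℱ`-slot of a bad index says: for EVERY `n ∈ N_{Π_{C_F}}(Π_v̲)` there is a
self-equivalence of the hull category `𝒞_v̲ = (D.frobeniusBadAt B I x hx).Cv` lying under `E ∘ conj_n ∘ E⁻¹` through `hull ⋙ toBase` (`E` the base seam
`badBaseEquiv`).  THE STAND-IN (A) (abc-iut-L5-t3 ★ `badTemperedSideModel` / `MergeInputs.ofGroupData`, record of record ★ `mergeInputsStandIn`):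
`𝒞_v̲ := 𝒞⊢_v̲` (the REAL monogenic `p_v̲`-adic Frobenioid over `𝒟⊢_v̲ = ℬ(G_v̲)⁰`) and `hull ⋙ toBase ≅ CdashBase ⋙ pull(aug)` (★ `sumHullBaseIso`).
WHAT THIS FILE PROVES (theorems only; 0 `def` · 0 `instance` · 0 notation · no `Prop` fact · no sorry):
* §1 **DESCENT** `InitialThetaData.exists_descend_transporter` — for ANY `H ≤ Π_{C_F}` lying over and surjecting onto `G_v̲ = decompAt` and ANY
  augmentation `aug : H → Gal(K̄_v̲/K_v̲)` that is `rhoAt`-COMPATIBLE («genuine»: `rhoAt (aug h) = augGF h`), every `n ∈ N_{Π_{C_F}}(H)` has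
  `augGF(n) ∈ N_{G_F}(G_v̲)`, and `ψ_n := rhoAtEquiv⁻¹ ∘ conj_{augGF n} ∘ rhoAtEquiv`, `ψ_{n⁻¹}` are mutually inverse CONTINUOUS endomorphisms of
  `Gal(K̄_v̲/K_v̲)` with `ψ_n ∘ aug = aug ∘ conj_n` (by `rhoAt_injective`) — the descent of the transporter along the augmentation.
* §2 **THE `𝒞⊢_v̲`-LIFT UNDER A TRANSPORTER** `Cor53ii.exists_cdashLift_under_transporter (… I x hx) (hT) (n)` — for ANY merge record `I` whose (m2)
  augmentation is the genuine one (`hT : ∀ h, rhoAt ((I.m2 x hx).aug h) = augGF h`, DISPLAYED): `E ∘ conj_n ∘ E⁻¹` lifts to `𝒞⊢_v̲` through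
  `CdashBase ⋙ incl` — descend `n⁻¹` (§1), lift `pull ψ` by this seat's gen-7 ★ `Cor53iii.exists_badDashLift_frobeniusBadAt_of_equivalence`
  ([IUTchI] Cor 5.3 (iii) at the bad `⊢`-slot: EVERY self-equivalence of `𝒟⊢_v̲` lifts), and paste the square `pull ψ ⋙ pull aug = pull aug ⋙ (E ⋙ conj ⋙ E⁻¹)`
  (abc-iut-w4-d058 ★ `CosetCat.pull_comp₃` / `pull_comp_eq_pull_comp`, ON THE NOSE); the summand-wise input for every stand-in containing `𝒞⊢_v̲`.
  **LIFT at stand-in (A)** `Cor53ii.liftsAll_hull_ofGroupData (… m2 m4 hTFG x hx) (hT)` — `LiftsAll` at ★ `badStructureFunctor` for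
  `I := MergeInputs.ofGroupData D B m2 m4 hTFG`, through ★ `sumHullBaseIso`.
* §3 **records of record, `hT` DISCHARGED**: `Cor53ii.liftsAll_hull_ofGroupData_ofClosed` (`m2 := m2OfClosed`, ★ `rhoAt_m2OfClosed_aug`) and
  **`Cor53ii.liftsAll_hull_standIn_model`** (`mergeInputsStandIn hA CG hTFG`, ★ `rhoAt_m2StandIn_aug`).
TOGETHER WITH ★ p534998 (`Cor53ii.not_kernelTrivial_hull_standIn_model`): at stand-in (A) the (ii) bad slot reads «hlift PROVED · hker REFUTED-AS-TYPED» —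
the model-case map `α ↦ toD(α)` of the `ℱ`-slot is SURJECTIVE and NOT injective there, i.e. print's (iii)-shape for a `⊢`-object (honest: OUR
`𝒞_v̲ := 𝒞⊢_v̲` is a `⊢`-object; print's `‡𝒞_v̲` is the full hull = lane 2's TM-pair INPUT-SHAPE).  CENSUS: binders = the kit's own {`CG`, `hS`, `M`, `hA`, `hI`,
`B`, `ΛBad`, `Fact l.Prime`} ∪ the record's {`m2`, `m4`, `hTFG`} / {`hH`} / {`hA`, `CG`, `hTFG`} ∪ {`x`, `hx`} ∪ §2's DISPLAYED `hT` (discharged in §3);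
LAW 0 · FACT 0.  typed ≠ inhabited ≠ proved; no token is moved by this file; nothing here asserts abc proved or refuted.
-/

noncomputable section

namespace Literature.IUT.HodgeTheaters

open CategoryTheory Opposite Literature.AnabelianGeometry.SemiGraphs Literature.AlgebraicGeometry.Frobenioids
  Literature.AlgebraicGeometry.Frobenioids.PadicFrd

namespace InitialThetaData

variable {F K Fbar : Type} [Field F] [NumberField F] [Field K] [NumberField K] [Algebra F K]
  [Field Fbar] [Algebra F Fbar] [Algebra K Fbar] {E : WeierstrassCurve F}
  [E.IsElliptic] {l : ℕ} {Pb : BadPlacePredicates K} (D : InitialThetaData F K Fbar E l Pb)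

/-! ### §1. Descent of a transporter along a genuine augmentation `Π_v̲ ↠ Gal(K̄_v̲/K_v̲)` -/

/-- **DESCENT OF TRANSPORTERS.**  Let `H ≤ Π_{C_F}` lie over `G_v̲ = decompAt x` (`hle`) and surject onto it (`hge`), and let `aug : H → Gal(K̄_v̲/K_v̲)` be
`rhoAt`-compatible (`rhoAt (aug h) = augGF h` — the genuine augmentation, e.g. abc-iut-L5-t2's `augOfOver`, `m2OfClosed`, `m2StandIn`).  Then for every
`n ∈ N_{Π_{C_F}}(H)` there are mutually inverse CONTINUOUS endomorphisms `ψ`, `ψ'` of `Gal(K̄_v̲/K_v̲)` — `ψ = rhoAtEquiv⁻¹ ∘ conj_{augGF n} ∘ rhoAtEquiv`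
(well defined since `augGF n` normalises `augGF(H) = G_v̲`) and `ψ'` the same for `n⁻¹` — with `ψ (aug h) = aug (n h n⁻¹)` and `ψ' (aug h) = aug (n⁻¹ h n)`.
OURS (group theory over abc-iut-L5-t2's `rhoAtEquiv`). ([IUTchI] Def 3.1 (e) p.62) [claim: Mochizuki2012, status: disputed] -/
theorem exists_descend_transporter (x : D.IndexCopy) (hx : x ∉ D.indexCopyArc) (H : Subgroup D.PiC)
    (hle : H ≤ (D.decompAt x).comap D.augGF) (hge : D.decompAt x ≤ H.map D.augGF) (aug : ↥H →* D.GalAt x hx)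
    (haug : ∀ h : ↥H, D.rhoAt x hx (aug h) = D.augGF h) (n : ↥(Subgroup.normalizer ((H : Subgroup D.PiC) : Set D.PiC))) :
    ∃ ψ ψ' : D.GalAt x hx →* D.GalAt x hx, Continuous ψ ∧ Continuous ψ' ∧
      ψ.comp ψ' = MonoidHom.id _ ∧ ψ'.comp ψ = MonoidHom.id _ ∧
      (∀ h : ↥H, ψ (aug h) = aug (PiTransport.conjSub H n h)) ∧ (∀ h : ↥H, ψ' (aug h) = aug (PiTransport.conjSub H n⁻¹ h)) := by
  haveI := D.isIntegral_F
  -- `G_v̲ = augGF(H)`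
  have hdec : D.decompAt x = H.map D.augGF := le_antisymm hge (Subgroup.map_le_iff_le_comap.2 hle)
  -- `augGF` maps `N(H)` into `N(G_v̲)`
  have hnorm : ∀ m : ↥(Subgroup.normalizer ((H : Subgroup D.PiC) : Set D.PiC)),
      D.augGF (m : D.PiC) ∈ Subgroup.normalizer (((D.decompAt x) : Subgroup (Fbar ≃ₐ[F] Fbar)) : Set (Fbar ≃ₐ[F] Fbar)) := by
    intro m
    rw [Subgroup.mem_normalizer_iff]
    intro γ
    rw [hdec]
    constructor
    · rintro ⟨h, hh, rfl⟩
      exact ⟨(m : D.PiC) * h * (m : D.PiC)⁻¹, (Subgroup.mem_normalizer_iff.mp m.2 h).mp hh, by rw [map_mul, map_mul, map_inv]⟩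
    · rintro ⟨h, hh, hγ⟩
      refine ⟨(m : D.PiC)⁻¹ * h * (m : D.PiC), ?_, ?_⟩
      · have h1 := (Subgroup.mem_normalizer_iff.mp (m⁻¹).2 h).mp hh
        simpa using h1
      · rw [map_mul, map_mul, map_inv, hγ]
        group
  -- the conjugations on `G_v̲`, transported to `Gal(K̄_v̲/K_v̲)` along `rhoAtEquiv`
  let e : D.GalAt x hx ≃ₜ* ↥(D.decompAt x) := D.rhoAtEquiv x hx
  let nm : ↥(Subgroup.normalizer ((H : Subgroup D.PiC) : Set D.PiC)) →
      ↥(Subgroup.normalizer (((D.decompAt x) : Subgroup (Fbar ≃ₐ[F] Fbar)) : Set (Fbar ≃ₐ[F] Fbar))) :=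
    fun m => ⟨D.augGF (m : D.PiC), hnorm m⟩
  let ψf : ↥(Subgroup.normalizer ((H : Subgroup D.PiC) : Set D.PiC)) → (D.GalAt x hx →* D.GalAt x hx) := fun m =>
    (e.symm : ↥(D.decompAt x) →* D.GalAt x hx).comp
      ((PiTransport.conjSub (D.decompAt x) (nm m)).comp (e : D.GalAt x hx →* ↥(D.decompAt x)))
  have hψf : ∀ m g, D.rhoAt x hx (ψf m g) = D.augGF (m : D.PiC) * D.rhoAt x hx g * (D.augGF (m : D.PiC))⁻¹ := by
    intro m g
    change D.rhoAt x hx (e.symm (PiTransport.conjSub (D.decompAt x) (nm m) (e g))) = _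
    rw [D.rhoAt_rhoAtEquiv_symm x hx, PiTransport.coe_conjSub, D.coe_rhoAtEquiv x hx]
  have hmul : ∀ m m' g, ψf m (ψf m' g) = ψf (m * m') g := by
    intro m m' g
    apply D.rhoAt_injective x hx
    rw [hψf, hψf, hψf, Subgroup.coe_mul, map_mul, mul_inv_rev]
    group
  have hone : ∀ g, ψf 1 g = g := by
    intro g
    apply D.rhoAt_injective x hx
    rw [hψf, Subgroup.coe_one, map_one, one_mul, inv_one, mul_one]
  have hcont : ∀ m, Continuous (ψf m) := fun m =>
    e.symm.continuous.comp ((PiTransport.continuous_conjSub (D.decompAt x) (nm m)).comp e.continuous)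
  have haug' : ∀ m (h : ↥H), ψf m (aug h) = aug (PiTransport.conjSub H m h) := by
    intro m h
    apply D.rhoAt_injective x hx
    rw [hψf, haug, haug, PiTransport.coe_conjSub, map_mul, map_mul, map_inv]
  refine ⟨ψf n, ψf n⁻¹, hcont n, hcont n⁻¹, ?_, ?_, haug' n, haug' n⁻¹⟩
  · refine MonoidHom.ext fun g => ?_
    rw [MonoidHom.comp_apply, hmul, mul_inv_cancel, hone, MonoidHom.id_apply]
  · refine MonoidHom.ext fun g => ?_
    rw [MonoidHom.comp_apply, hmul, inv_mul_cancel, hone, MonoidHom.id_apply]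

end InitialThetaData

/-! ### §2. The lift at stand-in (A): `hlift@hull` for `I := MergeInputs.ofGroupData D B m2 m4 hTFG` under the displayed `hT` -/

namespace Cor53ii

open InitialThetaData

variable {F K Fbar : Type} [Field F] [NumberField F] [Field K] [NumberField K] [Algebra F K]
  [Field Fbar] [Algebra F Fbar] [Algebra K Fbar] {E : WeierstrassCurve F}
  [E.IsElliptic] {l : ℕ} {Pb : BadPlacePredicates K} (D : InitialThetaData F K Fbar E l Pb)
  (CG : D.geom.pe.CuspGalois) (hS : D.CuspClassesNormaliserStable) [Fact l.Prime] (M : D.TorsionMonodromy)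
  (hA : D.geom.pe.ArrowCoveringClaims) (hI : ∀ k ∈ D.geom.pe.inertia D.geom.pe.ε1, M.tau (D.geom.embK k) = 0)
  (B : ∀ v, v ∈ D.indexCopyBad → D.BadPairAt v) (ΛBad : ∀ v (h : v ∈ D.indexCopyBad), D.LocalArrowLaw CG hS (B v h).H)
  (m2 : ∀ x (hx : x ∈ D.indexCopyBad), BadLocalGroupDatum (D.GalAt x (D.not_mem_arc_of_mem_bad hx)) ↥(B x hx).H)
  (m4 : RealifiedGlobalSide) (hTFG : D.geom.extF.GeomTFG) (x : D.IndexCopy) (hx : x ∈ D.indexCopyBad)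

/-- **THE `𝒞⊢_v̲`-LIFT UNDER A TRANSPORTER (any merge record `I`, genuine (m2) augmentation).**  For every `n ∈ N_{Π_{C_F}}(Π_v̲)` the
self-equivalence `E ∘ conj_n ∘ E⁻¹` of the kit's `𝒟_v̲ = CosetCat Π_v̲` (`E` the seam `badBaseEquiv`) LIFTS to a self-equivalence of the REAL
`𝒞⊢_v̲ = (D.frobeniusBadAt B I x hx).Cdash` through `CdashBase ⋙ incl` (`𝒞⊢_v̲ → 𝒟⊢_v̲ ⊆ 𝒟_v̲`): descend `n⁻¹` along the genuine augmentation
`(I.m2 x hx).aug` (§1, side condition `hT` DISPLAYED), lift `pull ψ` to `𝒞⊢_v̲` by this seat's gen-7 ★ `Cor53iii.exists_badDashLift_frobeniusBadAt_of_equivalence`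
([IUTchI] Cor 5.3 (iii): EVERY self-equivalence of `𝒟⊢_v̲` lifts), and paste the base square `pull ψ ⋙ pull aug = pull aug ⋙ (E ⋙ conj_n ⋙ E⁻¹)`
(abc-iut-w4-d058 ★ `CosetCat.pull_comp₃` / `pull_comp_eq_pull_comp`, ON THE NOSE).  Independent of the (m1) slot; the summand-wise input for
every stand-in whose hull contains `𝒞⊢_v̲`. ([IUTchI] Cor 5.3 (iii) p.144) [claim: Mochizuki2012, status: disputed] -/
theorem exists_cdashLift_under_transporter (I : D.MergeInputs B)
    (hT : ∀ h : ↥(B x hx).H, D.rhoAt x (D.not_mem_arc_of_mem_bad hx) ((I.m2 x hx).aug h) = D.augGF h)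
    (n : ↥(Subgroup.normalizer (((D.localDataOfBadPairs CG hS M hA hI B ΛBad x).H : Subgroup D.PiC) : Set D.PiC))) :
    ∃ Ψ : (D.frobeniusBadAt B I x hx).Cdash ≌ (D.frobeniusBadAt B I x hx).Cdash,
      Nonempty (CatIsomorphism.LiesUnder ((D.frobeniusBadAt B I x hx).CdashBase ⋙ (I.m2 x hx).incl)
        ((D.frobeniusBadAt B I x hx).CdashBase ⋙ (I.m2 x hx).incl) Ψ
        (((D.badBaseEquiv CG hS M hA hI B ΛBad x hx).trans
          (PiTransport.conjSelfEquiv ((D.localDataOfBadPairs CG hS M hA hI B ΛBad x).H) n)).trans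
            (D.badBaseEquiv CG hS M hA hI B ΛBad x hx).symm)) := by
  haveI : Fact (D.primeAt x (D.not_mem_arc_of_mem_bad hx)).Prime := D.fact_primeAt_prime x _
  -- the seam `H' = (B x hx).H` between the kit's local group at `x` and the pair's
  have hseam : (D.localDataOfBadPairs CG hS M hA hI B ΛBad x).H = (B x hx).H :=
    D.localDataOfBadPairs_H_of_mem_bad CG hS M hA hI B ΛBad x hx
  have hn' : (((n⁻¹ : ↥(Subgroup.normalizer (((D.localDataOfBadPairs CG hS M hA hI B ΛBad x).H : Subgroup D.PiC) : Set D.PiC))) :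
        ↥(Subgroup.normalizer _)) : D.PiC) ∈ Subgroup.normalizer (((B x hx).H : Subgroup D.PiC) : Set D.PiC) := by
    rw [← hseam]
    exact (n⁻¹).2
  -- §1: descend `n⁻¹` along the genuine augmentation of `(I.m2 x hx)`
  obtain ⟨ψ, ψ', hc, hc', h₁, h₂, hψ, -⟩ := D.exists_descend_transporter x (D.not_mem_arc_of_mem_bad hx) (B x hx).H
    (D.badPairAt_H_le_comap_decompAt B x hx) (D.decompAt_le_map_augGF_badPairAt_H B x hx) (I.m2 x hx).aug hT ⟨_, hn'⟩
  -- [IUTchI] Cor 5.3 (iii) at the bad `⊢`-slot: lift `pull ψ` to `𝒞⊢_v̲`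
  obtain ⟨Ψ, ⟨j⟩, -⟩ := Cor53iii.exists_badDashLift_frobeniusBadAt_of_equivalence D B I x hx
    (PiTransport.pullSelfEquiv ψ ψ' hc hc' h₁ h₂)
  refine ⟨Ψ, ⟨?_⟩⟩
  -- the base square ON THE NOSE: `pull ψ ⋙ pull aug = pull aug ⋙ (pull ι₁ ⋙ pull conj_{n⁻¹} ⋙ pull ι₂)`
  have hsψ : Function.Surjective ψ := fun g => ⟨ψ' g, DFunLike.congr_fun h₁ g⟩
  let κ : ↥(B x hx).H →* ↥(B x hx).H :=
    ((Subgroup.inclusion hseam.symm.symm.le).comp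
      (PiTransport.conjSub ((D.localDataOfBadPairs CG hS M hA hI B ΛBad x).H) n⁻¹)).comp (Subgroup.inclusion hseam.symm.le)
  have hκ : ∀ h, κ h = PiTransport.conjSub (B x hx).H ⟨_, hn'⟩ h := fun h => Subtype.ext rfl
  have hκc : Continuous κ :=
    ((Continuous.subtype_mk continuous_subtype_val _).comp (PiTransport.continuous_conjSub _ n⁻¹)).comp
      (Continuous.subtype_mk continuous_subtype_val _)
  have hκs : Function.Surjective κ := by
    intro h
    refine ⟨PiTransport.conjSub (B x hx).H ⟨_, hn'⟩⁻¹ h, ?_⟩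
    rw [hκ, ← MonoidHom.comp_apply, PiTransport.conjSub_comp_inv, MonoidHom.id_apply]
  have hcomm : ψ.comp (I.m2 x hx).aug = (I.m2 x hx).aug.comp κ :=
    MonoidHom.ext fun h => by rw [MonoidHom.comp_apply, MonoidHom.comp_apply, hψ, hκ]
  have key : (PiTransport.pullSelfEquiv ψ ψ' hc hc' h₁ h₂).functor ⋙ (I.m2 x hx).incl =
      (I.m2 x hx).incl ⋙ (((D.badBaseEquiv CG hS M hA hI B ΛBad x hx).trans
        (PiTransport.conjSelfEquiv ((D.localDataOfBadPairs CG hS M hA hI B ΛBad x).H) n)).trans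
          (D.badBaseEquiv CG hS M hA hI B ΛBad x hx).symm).functor := by
    change CosetCat.pull ψ hc hsψ ⋙ CosetCat.pull (I.m2 x hx).aug (I.m2 x hx).continuous_aug (I.m2 x hx).surjective_aug =
      CosetCat.pull (I.m2 x hx).aug (I.m2 x hx).continuous_aug (I.m2 x hx).surjective_aug ⋙
        (CosetCat.pull (Subgroup.inclusion hseam.symm.symm.le) (Continuous.subtype_mk continuous_subtype_val _) _ ⋙
          CosetCat.pull (PiTransport.conjSub ((D.localDataOfBadPairs CG hS M hA hI B ΛBad x).H) n⁻¹)
            (PiTransport.continuous_conjSub _ n⁻¹) _ ⋙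
          CosetCat.pull (Subgroup.inclusion hseam.symm.le) (Continuous.subtype_mk continuous_subtype_val _) _)
    rw [CosetCat.pull_comp₃ _ _ _ _ _ _ (Subgroup.inclusion hseam.symm.le) (Continuous.subtype_mk continuous_subtype_val _) _ hκc hκs]
    exact CosetCat.pull_comp_eq_pull_comp _ _ _ _ _ _ _ _ _ κ hκc hκs hcomm
  -- paste the lift square `j` (over `𝒟⊢_v̲`) with the base square `key`
  exact (Functor.associator _ _ _).symm ≪≫ Functor.isoWhiskerRight j _ ≪≫ Functor.associator _ _ _ ≪≫
    Functor.isoWhiskerLeft _ (eqToIso key) ≪≫ (Functor.associator _ _ _).symm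

/-- **`hlift@hull` IS A THEOREM at stand-in (A).**  For the merge record `I := MergeInputs.ofGroupData D B m2 m4 hTFG` (hull `𝒞_v̲ := 𝒞⊢_v̲`) and a
(m2) whose augmentation is the GENUINE one (`hT : rhoAt ((m2 x hx).aug h) = augGF h`, DISPLAYED), the surjectivity half `LiftsAll` of the Cor 5.3 (ii)
model case at the `ℱ`-slot of the bad index `x` (★ `badLiftAt_model_case_iff`) HOLDS over the genuine §6 base kit of record: every transporter
`n ∈ N_{Π_{C_F}}(Π_v̲)` lifts to `𝒞⊢_v̲` (`exists_cdashLift_under_transporter`), read through `hull ⋙ toBase ≅ CdashBase ⋙ incl` (★ `sumHullBaseIso`).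
OURS, at OUR stand-in; print's (ii) surjectivity argument is [AbsTopIII] Thm 1.9 at `ℬ^temp(X̲̲_v)⁰`, not this.
([IUTchI] Cor 5.3 (ii) p.144) [claim: Mochizuki2012, status: disputed] -/
theorem liftsAll_hull_ofGroupData
    (hT : ∀ h : ↥(B x hx).H, D.rhoAt x (D.not_mem_arc_of_mem_bad hx) ((m2 x hx).aug h) = D.augGF h) :
    CatIsomorphism.LiftsAll (D.badStructureFunctor CG hS M hA hI B ΛBad (MergeInputs.ofGroupData D B m2 m4 hTFG) x hx)
      ((D.baseKitThetaNFOfBadPairs CG hS M hA hI B ΛBad).model x) (D.modelAutToCatAut CG hS M hA hI B ΛBad x) := by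
  haveI : Fact (D.primeAt x (D.not_mem_arc_of_mem_bad hx)).Prime := D.fact_primeAt_prime x _
  refine (D.badLiftsAllAt_iff CG hS M hA hI B ΛBad (MergeInputs.ofGroupData D B m2 m4 hTFG) x hx).2 fun n => ?_
  obtain ⟨Ψ, ⟨k⟩⟩ := exists_cdashLift_under_transporter D CG hS M hA hI B ΛBad x hx (MergeInputs.ofGroupData D B m2 m4 hTFG) hT n
  -- `hull ⋙ toBase ≅ CdashBase ⋙ incl` at the sum-model stand-in (abc-iut-L5-t3 `sumHullBaseIso`)
  let i := TemperedThetaInput.sumHullBaseIso (D.gvdAt x (D.not_mem_arc_of_mem_bad hx)) (m2 x hx) (D.qRootAtIdx_not_isUnit x hx)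
  exact ⟨Ψ, ⟨Functor.isoWhiskerLeft Ψ.functor i ≪≫ k ≪≫ Functor.isoWhiskerRight i.symm _⟩⟩

/-! ### §3. The records of record: `hT` discharged -/

/-- **`hlift@hull` at EVERY CLOSED bad-pair family with the sum-model (m1)** (`m2 := m2OfClosed`, abc-iut-L5-t2 — its augmentation is `augOfOver`,
`rhoAt`-compatible by ★ `rhoAt_m2OfClosed_aug`): `LiftsAll` at the `ℱ`-slot of every bad index, NO side condition. ([IUTchI] Cor 5.3 (ii) p.144)
[claim: Mochizuki2012, status: disputed] -/
theorem liftsAll_hull_ofGroupData_ofClosed (hH : ∀ x (hx : x ∈ D.indexCopyBad), IsClosed ((B x hx).H : Set D.PiC)) :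
    CatIsomorphism.LiftsAll
      (D.badStructureFunctor CG hS M hA hI B ΛBad (MergeInputs.ofGroupData D B (fun x hx => D.m2OfClosed B x hx (hH x hx)) m4 hTFG) x hx)
      ((D.baseKitThetaNFOfBadPairs CG hS M hA hI B ΛBad).model x) (D.modelAutToCatAut CG hS M hA hI B ΛBad x) :=
  liftsAll_hull_ofGroupData D CG hS M hA hI B ΛBad _ m4 hTFG x hx (D.rhoAt_m2OfClosed_aug B x hx (hH x hx))

/-- **HEADLINE (A): `hlift@hull` IS A THEOREM at THE sum-model stand-in of record** `D.mergeInputsStandIn hA CG hTFG` (abc-iut-L5-t3 / abc-iut-w4-d077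
★ p501395/★ p500756; (m2) = `m2StandIn`, GENUINE augmentation — `rhoAt`-compatible by ★ `rhoAt_m2StandIn_aug`): over the genuine §6 base kit of the
`X̲→`-stand-in family `fun v _ => D.badPairAtArrow hA v` (kit binders `hS`, `M`, `hI`, `ΛBad`), `LiftsAll` at the `ℱ`-slot of EVERY bad index.  With ★ p534998
(`not_kernelTrivial_hull_standIn_model`): there the model-case map is SURJECTIVE, NOT injective. ([IUTchI] Cor 5.3 (ii) p.144) [claim: Mochizuki2012, status: disputed] -/
theorem liftsAll_hull_standIn_model (ΛBad' : ∀ v (h : v ∈ D.indexCopyBad), D.LocalArrowLaw CG hS (D.badPairAtArrow hA v).H) :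
    CatIsomorphism.LiftsAll
      (D.badStructureFunctor CG hS M hA hI (fun v _ => D.badPairAtArrow hA v) ΛBad' (D.mergeInputsStandIn hA CG hTFG) x hx)
      ((D.baseKitThetaNFOfBadPairs CG hS M hA hI (fun v _ => D.badPairAtArrow hA v) ΛBad').model x)
      (D.modelAutToCatAut CG hS M hA hI (fun v _ => D.badPairAtArrow hA v) ΛBad' x) :=
  haveI : Fact (D.primeAt x (D.not_mem_arc_of_mem_bad hx)).Prime := D.fact_primeAt_prime x _
  liftsAll_hull_ofGroupData D CG hS M hA hI (fun v _ => D.badPairAtArrow hA v) ΛBad' _ _ hTFG x hx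
    (fun h => D.rhoAt_m2StandIn_aug hA CG x (D.not_mem_arc_of_mem_bad hx) hTFG h)

end Cor53ii

end Literature.IUT.HodgeTheaters

end
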